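import Summits.PneNP.PneNP.Theorems.ChebyshevTracialDesignCrossingPinTracial
import Summits.PneNP.PneNP.Theorems.ChebyshevTracialDesignRungCells
import HarnessLib

/-!
# Cell pnp-psdrank, route `ChebyshevTracialDesign`: the ONE-CORE STEP for MATRIX strategies — a matching side supported on the star of a core
# `S` splits the design value into pattern cells; the crossing cells are `O(B·r·√P_{D−4})` each, the non-crossing cells are reduced instances
# (crux `TracialDecayExp20`, stmt-PneNP-19878)

Brick 92 (prover g17; MEMO-20 §2(e): the one-core recursion step, by name). For a pair of contraction families `(X, Y)` of any dimension `r` with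
the matching side supported on the star `{M ⊇ S}` of a core `S` (a perfect matching of `V`, as produced by a Kupavskii–Zakharov-type pinning):
* §1 `value_eq_sum_patterns_of_star` — `Σ_{U,M} W·tr(X_U Y_M) = Σ_{π ⊆ V} Σ_{U ∩ V = π} Σ_{M ⊇ S} W·tr(X_U Y_M)` (brick 30's pattern partition, generic);
* §2 **`abs_crossing_cell_trace_le`** — if some core edge `e ∈ S` crosses the pattern `π`, the cell is a crossing-pinned pair (every `U` of the cell is
  crossed by `e`, every `M ⊇ S` contains `e`), so brick 24b (`…CrossingPinTracial.crossingPin_tracial_value_le_of_contractions`) prices it: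
  `|cell_π| ≤ B_v·r·√P_{D−4}` — r-uniformly, for every `X`;
* §3 **`value_le_noncrossing_cells_add`** — hence `Σ_{U,M} W·tr(X_U Y_M) ≤ Σ_{π ⊆ V, crossCount π S = 0} cell_π + 2^{|V|}·B_v·r·√P_{D−4}`, and each
  remaining non-crossing cell is `ρ_π(0)` × the reduced strategy against the reduced design in `K_{n−|V|}` (brick 91
  `…MatrixCellReduction.noncrossing_cell_trace_eq_reduced_univ`), where the four-part price list (88c: SIGN at all degrees ⊕ DOMINATION ⊕ JUNK ⊕
  slack) applies. This is the matrix form of the r = 1 rung's step S6 (bricks 30/31): what the matrix programme still lacks is the CHOICE of cores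
  (a Kupavskii–Zakharov decomposition of a psd-contraction field on PM_n with piece count ≤ r·τ^{−O(q)}, MEMO-20 §2(e) (MKZ)).
[cite: Rothvoss2017, §2 and Lemma 7 (PDF pp. 6–8)] [cite: KupavskiiZakharov2022, §2 and Lemma 11] [cite: Grigoriev2001, Lemma 1.4 (PDF p. 8)]
[cite: GriblingDelaatLaurent2019, §5]
Stature: support/instrument (kernel lane, no defs, axioms standard). WHAT THIS IS NOT: no pin-selection theorem, no proof or refutation of the crux,
nothing on psd rank of P_PM(K_n), no P-vs-NP content. Supports stmt-PneNP-19878.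
-/

set_option linter.dupNamespace false -- `Summit.PneNP.PneNP.…`: summit = sub-problem (D-0017)

noncomputable section

namespace Summit.PneNP.PneNP.Theorems.ChebyshevTracialDesignMatrixCoreStep

open Finset Matrix Literature.Barriers.PneNP Literature.Combinatorics.Optimization
open Literature.Combinatorics.SimpleGraph.CycleSpace
open Literature.Combinatorics.AssociationSchemes.CutMatchingRestriction
open Summit.PneNP.PneNP.Theorems.ChebyshevTracialDesignRungCells (sum_eq_sum_patterns)
open Summit.PneNP.PneNP.Theorems.ChebyshevTracialDesignCrossingPinTracial (crossingPin_tracial_value_le_of_contractions)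

variable {n r : ℕ}

/-! ### §1 Pattern partition of a star-supported pair -/

/-- **Pattern partition.** If the matching side vanishes off the star of `S` (`Y_M = 0` unless `S ⊆ M`), then for every vertex set `V`:
`Σ_{U,M} W(U,M)·tr(X_U Y_M) = Σ_{π ⊆ V} Σ_{U : U ∩ V = π} Σ_{M : S ⊆ M} W(U,M)·tr(X_U Y_M)`. [cite: Rothvoss2017, §2 (PDF p. 6)]
[cite: KupavskiiZakharov2022, §2] -/
theorem value_eq_sum_patterns_of_star (W : OddSet n → PMatch n → ℝ) (V : Finset (Fin n)) (S : Finset (Sym2 (Fin n)))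
    (X : OddSet n → Matrix (Fin r) (Fin r) ℝ) (Y : PMatch n → Matrix (Fin r) (Fin r) ℝ) (hYS : ∀ M, ¬ S ⊆ M.1 → Y M = 0) :
    ∑ U, ∑ M, W U M * (X U * Y M).trace =
      ∑ π ∈ V.powerset, ∑ U ∈ univ.filter (fun U : OddSet n => U.1 ∩ V = π),
        ∑ M ∈ univ.filter (fun M : PMatch n => S ⊆ M.1), W U M * (X U * Y M).trace := by
  have hinner : ∀ U : OddSet n, ∑ M, W U M * (X U * Y M).trace =
      ∑ M ∈ univ.filter (fun M : PMatch n => S ⊆ M.1), W U M * (X U * Y M).trace := by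
    intro U
    rw [sum_filter]
    refine sum_congr rfl fun M _ => ?_
    split_ifs with hM
    · rfl
    · rw [hYS M hM, Matrix.mul_zero, trace_zero, mul_zero]
  simp_rw [hinner]
  exact sum_eq_sum_patterns univ V _

/-! ### §2 Crossing cells are crossing-pinned pairs -/

/-- A pattern with a positive crossing count is crossed by some core edge. [folklore] -/
theorem exists_crosses_of_crossCount_ne_zero {π : Finset (Fin n)} {S : Finset (Sym2 (Fin n))} (h : crossCount π S ≠ 0) :
    ∃ e ∈ S, Crosses π e := by
  rw [crossCount] at h
  obtain ⟨e, he⟩ := card_pos.1 (Nat.pos_of_ne_zero h)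
  exact ⟨e, (mem_filter.1 he).1, (mem_filter.1 he).2⟩

/-- **CROSSING CELLS ARE TINY, AT EVERY DIMENSION.** For `n` even, an exact design `(n, t = 2c'+1, T, D, B_v, C, w)` with `4 ≤ D ≤ 2c'`, contraction
families `X`, `Y`, a core `S ⊆ V.sym2` and a pattern `π` crossed by some core edge (`crossCount π S ≠ 0`):
`|Σ_{U ∩ V = π} Σ_{M ⊇ S} W·tr(X_U Y_M)| ≤ B_v·r·√P_{D−4}` — the cell, extended by zero, is a pair supported on `{U crossed by e} × {M ∋ e}` and
brick 24b applies. [cite: Rothvoss2017, §2 and Lemma 7 (PDF pp. 6–8)] [cite: Grigoriev2001, Lemma 1.4 (PDF p. 8)] -/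
theorem abs_crossing_cell_trace_le {c' T D : ℕ} {Bv : ℝ} {C : Finset ℕ} {w : ℕ → ℝ} (hn : Even n)
    (hdes : IsExactDesign n (2 * c' + 1) T D Bv C w) (hD : D ≤ 2 * c') (hD4 : 4 ≤ D)
    (X : OddSet n → Matrix (Fin r) (Fin r) ℝ) (Y : PMatch n → Matrix (Fin r) (Fin r) ℝ)
    (hX : ∀ U, (X U).PosSemidef ∧ (1 - X U).PosSemidef) (hY : ∀ M, (Y M).PosSemidef ∧ (1 - Y M).PosSemidef)
    {V π : Finset (Fin n)} {S : Finset (Sym2 (Fin n))} (hSV : S ⊆ V.sym2) (hcross : crossCount π S ≠ 0) :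
    |∑ U ∈ univ.filter (fun U : OddSet n => U.1 ∩ V = π),
        ∑ M ∈ univ.filter (fun M : PMatch n => S ⊆ M.1), levelWeight n (2 * c' + 1) C w U M * (X U * Y M).trace| ≤
      Bv * ((r : ℝ) * Real.sqrt (∏ i ∈ range ((D - 4) / 2 + 1), ((2 * i + 1 : ℝ) / ((n : ℝ) - 2 * i)))) := by
  classical
  obtain ⟨e, heS, hcr⟩ := exists_crosses_of_crossCount_ne_zero hcross
  have heV : e ∈ V.sym2 := hSV heS
  -- the cell, extended by zero
  set X' : OddSet n → Matrix (Fin r) (Fin r) ℝ := fun U => if U.1 ∩ V = π then X U else 0 with hX'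
  set Y' : PMatch n → Matrix (Fin r) (Fin r) ℝ := fun M => if S ⊆ M.1 then Y M else 0 with hY'
  have hzero : (0 : Matrix (Fin r) (Fin r) ℝ).PosSemidef ∧ (1 - (0 : Matrix (Fin r) (Fin r) ℝ)).PosSemidef :=
    ⟨PosSemidef.zero, by rw [sub_zero]; exact PosSemidef.one⟩
  have hX'c : ∀ U, (X' U).PosSemidef ∧ (1 - X' U).PosSemidef := fun U => by
    rw [hX']; dsimp only; split_ifs
    · exact hX U
    · exact hzero
  have hY'c : ∀ M, (Y' M).PosSemidef ∧ (1 - Y' M).PosSemidef := fun M => by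
    rw [hY']; dsimp only; split_ifs
    · exact hY M
    · exact hzero
  have hsum : ∑ U ∈ univ.filter (fun U : OddSet n => U.1 ∩ V = π),
      ∑ M ∈ univ.filter (fun M : PMatch n => S ⊆ M.1), levelWeight n (2 * c' + 1) C w U M * (X U * Y M).trace =
      ∑ U, ∑ M, levelWeight n (2 * c' + 1) C w U M * (X' U * Y' M).trace := by
    rw [sum_filter]
    refine sum_congr rfl fun U _ => ?_
    split_ifs with hU
    · rw [sum_filter]
      refine sum_congr rfl fun M _ => ?_
      split_ifs with hM
      · rw [hX', hY']; dsimp only; rw [if_pos hU, if_pos hM]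
      · rw [hY']; dsimp only; rw [if_neg hM, Matrix.mul_zero, trace_zero, mul_zero]
    · symm
      refine sum_eq_zero fun M _ => ?_
      rw [hX']; dsimp only; rw [if_neg hU, Matrix.zero_mul, trace_zero, mul_zero]
  rw [hsum]
  -- name the crossing edge
  revert heS hcr heV
  induction e using Sym2.ind with
  | h a b =>
    intro heS hcr heV
    refine crossingPin_tracial_value_le_of_contractions hn hdes hD hD4 a b X' Y' (fun U hU => ?_) (fun M hM => ?_) hX'c hY'c
    · -- a cut not crossed by `e` is outside the cell
      rw [hX']; dsimp only
      rw [if_neg]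
      intro hUV
      apply hU
      rw [crosses_iff_crosses_inter heV, hUV]
      exact hcr
    · -- a matching without `e` is outside the star
      rw [hY']; dsimp only
      rw [if_neg]
      exact fun hSM => hM (hSM heS)

/-! ### §3 The one-core step: only non-crossing cells remain -/

/-- **THE ONE-CORE STEP.** In the setting of §2 with the matching side supported on the star of the core `S ⊆ V.sym2`:
`Σ_{U,M} W·tr(X_U Y_M) ≤ Σ_{π ⊆ V, crossCount π S = 0} cell_π + 2^{|V|}·B_v·r·√P_{D−4}`, where each non-crossing cell `cell_π` is, by brick 91
(`…MatrixCellReduction.noncrossing_cell_trace_eq_reduced_univ`), `ρ_π(0)` times the design value of the reduced strategy against the reduced design in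
`K_{n−|V|}`. [cite: Rothvoss2017, §2 and Lemma 7 (PDF pp. 6–8)] [cite: KupavskiiZakharov2022, §2 and Lemma 11] [cite: GriblingDelaatLaurent2019, §5] -/
theorem value_le_noncrossing_cells_add {c' T D : ℕ} {Bv : ℝ} {C : Finset ℕ} {w : ℕ → ℝ} (hn : Even n)
    (hdes : IsExactDesign n (2 * c' + 1) T D Bv C w) (hD : D ≤ 2 * c') (hD4 : 4 ≤ D)
    (X : OddSet n → Matrix (Fin r) (Fin r) ℝ) (Y : PMatch n → Matrix (Fin r) (Fin r) ℝ)
    (hX : ∀ U, (X U).PosSemidef ∧ (1 - X U).PosSemidef) (hY : ∀ M, (Y M).PosSemidef ∧ (1 - Y M).PosSemidef)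
    {V : Finset (Fin n)} {S : Finset (Sym2 (Fin n))} (hSV : S ⊆ V.sym2) (hYS : ∀ M, ¬ S ⊆ M.1 → Y M = 0) :
    ∑ U, ∑ M, levelWeight n (2 * c' + 1) C w U M * (X U * Y M).trace ≤
      ∑ π ∈ V.powerset.filter (fun π => crossCount π S = 0),
          ∑ U ∈ univ.filter (fun U : OddSet n => U.1 ∩ V = π),
            ∑ M ∈ univ.filter (fun M : PMatch n => S ⊆ M.1), levelWeight n (2 * c' + 1) C w U M * (X U * Y M).trace +
        (2 : ℝ) ^ V.card * (Bv * ((r : ℝ) * Real.sqrt (∏ i ∈ range ((D - 4) / 2 + 1), ((2 * i + 1 : ℝ) / ((n : ℝ) - 2 * i))))) := by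
  classical
  set cell : Finset (Fin n) → ℝ := fun π => ∑ U ∈ univ.filter (fun U : OddSet n => U.1 ∩ V = π),
    ∑ M ∈ univ.filter (fun M : PMatch n => S ⊆ M.1), levelWeight n (2 * c' + 1) C w U M * (X U * Y M).trace with hcell
  set β : ℝ := Bv * ((r : ℝ) * Real.sqrt (∏ i ∈ range ((D - 4) / 2 + 1), ((2 * i + 1 : ℝ) / ((n : ℝ) - 2 * i)))) with hβ
  have hsplit : ∑ U, ∑ M, levelWeight n (2 * c' + 1) C w U M * (X U * Y M).trace =
      ∑ π ∈ V.powerset.filter (fun π => crossCount π S = 0), cell π + ∑ π ∈ V.powerset.filter (fun π => ¬ crossCount π S = 0), cell π := by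
    rw [value_eq_sum_patterns_of_star _ V S X Y hYS, ← sum_filter_add_sum_filter_not V.powerset (fun π => crossCount π S = 0)]
  rw [hsplit]
  refine add_le_add le_rfl ?_
  -- the crossing cells
  have hcells : ∀ π ∈ V.powerset.filter (fun π => ¬ crossCount π S = 0), cell π ≤ β := fun π hπ =>
    (le_abs_self _).trans (abs_crossing_cell_trace_le hn hdes hD hD4 X Y hX hY hSV (mem_filter.1 hπ).2)
  have hβ0 : 0 ≤ β := by
    have hBv : 0 ≤ Bv := (sum_nonneg fun c _ => abs_nonneg (w c)).trans hdes.2.2.2.2.2.2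
    rw [hβ]; positivity
  calc ∑ π ∈ V.powerset.filter (fun π => ¬ crossCount π S = 0), cell π
      ≤ ∑ _π ∈ V.powerset.filter (fun π => ¬ crossCount π S = 0), β := sum_le_sum hcells
    _ = ((V.powerset.filter (fun π => ¬ crossCount π S = 0)).card : ℝ) * β := by rw [sum_const, nsmul_eq_mul]
    _ ≤ (2 : ℝ) ^ V.card * β := by
        refine mul_le_mul_of_nonneg_right ?_ hβ0
        have h1 := card_filter_le V.powerset (fun π => ¬ crossCount π S = 0)
        rw [card_powerset] at h1
        exact_mod_cast h1

end Summit.PneNP.PneNP.Theorems.ChebyshevTracialDesignMatrixCoreStep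

end
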